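import Summits.Parity.BatemanHorn.Theses.IsogenyRedei

/-!
# Disproof of `SplitBlockJacobiCorner` (stmt-Parity-15002) — standing adversary file (cdisprove seat, cycle 1)

Crux (route IsogenyRedei, rank 4; the judge's "any nontrivial bound on J_θ for some θ < 1", typed):
`∃ δ > 0, ∀ θ > 1/2, ∀ μ ∈ [1−δ, 2−2θ): J^c_{θ,μ}(x) := Σ_{t ≤ x} Σ_{(Q,Q') ∈ pf(t²+1)², x^θ < Q < Q', QQ' ≤ x^{2−μ}} (Q|Q') = o(x)`.

VERDICT OF CYCLE 1: NO KILL.  The statement elaborates and says what the docstring says; it is `O(x)` trivially and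
`o(x)` is genuine content (corner mass `≍ x`, measured `N/x = 0.031` at `(θ,λ) = (0.5, 1.2)`, `λ := 2 − μ`); every cheap
attack below fails, and the numerics (this seat, `exp/corner.c`, `exp/ec.c`, x ≤ 10⁸ locally, kit j016582 for 10⁹/4·10⁹)
show the OPEN part of the corner — the root DISCREPANCY `D^c = J^c − E^c` — at pure noise level (`|D^c| ≤ 2.41√N` in
every cell up to `x = 4·10⁹`), while `|J^c|/N ≤ 9·10⁻⁴` at 4·10⁹ and decreasing: no drift, no kill.

## Findings (index; details in the docstrings)

* §0 `cpairs`, `Jc`, `splitBlockJacobiCorner_iff` (`Iff.rfl`).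
* §A LOAD-BEARING ANALYSIS of the three hypotheses `1/2 < θ`, `1 − δ ≤ μ`, `μ < 2 − 2θ`:
  - `μ < 2 − 2θ` is NOT load-bearing (PROVED): for `μ ≥ 2 − 2θ` every corner pair set is empty
    (`cpairs_eq_empty_of_le`: `x^θ < Q < Q'` forces `QQ' > x^{2θ} ≥ x^{2−μ}`), so `Jc θ μ x = 0` and
    `SplitBlockJacobiCorner ↔ SplitBlockJacobiCornerWithoutMuUpper` (`splitBlockJacobiCorner_iff_withoutMuUpper`).
    (Landing as `Theorems/SplitBlockJacobiCorner/Negative/MuUpperRedundant.lean`.)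
  - `1 − δ ≤ μ` IS the corner: dropping it lets `μ = 0`, and `Jc θ 0 x` differs from the sister crux's `J_θ(x)`
    (`SplitBlockJacobi`, stmt-Parity-11583, co-rank 2, open) only in the `t = x`, `QQ' = x²+1` terms — so the
    statement without it is at least as strong as `SplitBlockJacobi` for every `θ ∈ (1/2,1)` (not attacked here; see
    `Cruxes/SplitBlockJacobi/Disproof.lean`, which I cite for: `1/2<θ` analysis, `≤ 3` big primes, Aurifeuillian and
    difference-square families, kill table to 10⁸).
  - `1/2 < θ`: guarantees `QQ' > x` (every modulus beyond `x`, ≤ 3 pairs per `t`).  Dropping it ENTIRELY is false by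
    the sister seat's measurement (`θ = 0`: `J_0(x)/x → c₀ = Σ_{Q<Q'}(Q|Q')ρ(Q)ρ(Q')/(QQ') ≈ −0.43`, kit j004900/j004903;
    the corner cut `QQ' ≤ x^{2−μ}` does not remove the small pairs), recorded as the near-miss
    `not_SplitBlockJacobiCornerWithoutThetaLower` (`sorry`: an effective tail bound for a conditionally convergent
    double prime series is not cheaply formalisable).  For `0 < θ ≤ 1/2` the corner statement is heuristically still
    true (tail of the same series, `≍ x^{1−θ}`-size secular term, `o(x)`), so the honest content of `1/2 < θ` is
    structural (modulus beyond `x`), not truth-relevant — information for the prover.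
* §B SIGN-COHERENT FAMILY INSIDE THE CORNER (PROVED): `jacobiSym_eq_one_of_eq_add_four_mul_sq` — every pair with
  `Q' − Q = 4s²` has `(Q|Q') = +1`.  MEASURED: this family is exactly the positive bias of the corner's tip
  (x = 10⁷, θ = 1/2, λ ≤ 1.02: 271 of the 3763 triples have `Q'−Q = 4□`, all `+1`, total `J = +241`); its size in a
  corner cell is `NSQ(x) = 980, 5062, 25774` at `x = 10⁶, 10⁷, 10⁸` for `(θ,λ) = (0.5,1.2)` (growth `×5.1/decade ≈
  x^{0.7}`, i.e. `≍ x^{1−θ/2}/log`), and it AGREES with the independent-roots prediction `Esq = Σ_{prime pairs, Δ=4□}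
  4x/(QQ') = 1031.6, 5079.4, 25565.1` — no correlation between the family and small roots.  So the natural
  strengthening "`J^c = O(√N)`" is FALSE (a deterministic `+x^{1−θ/2+o(1)}` term), but the family is `o(x)`:
  not a kill.  (Landing as `Theorems/SplitBlockJacobiCorner/Negative/ForcedSquareFamily.lean`.)
* §C THE DECISIVE NUMERICS — expected part versus discrepancy (exp/corner.c + exp/ec.c, this seat; 10⁹ and 4·10⁹ by
  kit j016582, tables `corner_X*.txt` attached to the item).  With `N = #triples`, `M = Σ_{prime pairs in the cell}
  4x/(QQ')` (expected mass), `E = Σ (Q|Q')·4x/(QQ')` (expected part: `= o(x)` is the landed `stub_expectedPart`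
  rescaled, i.e. `stub_cornerExpectedPart` of line Sketch), `D := J − E` (the OPEN part, the root discrepancy
  twisted by the symbol — what `MixedBilinearBalanced` / `TierWeylBound` must deliver), cell `(θ, λ)`, `λ := 2 − μ`:
  ```
     x    (θ,λ)          N        J/N       J       E(exp)       D    D/√N     NSQ     Esq
    1e6  (.5,1.2)      30703  -1.2e-2     -355     -251.0     -104  -0.59     980    1032
    1e7  (.5,1.2)     307206  -3.0e-3     -914     -954.3      +40  +0.07    5062    5079
    1e8  (.5,1.2)    3083723  -2.9e-3    -9091    -9059.6      -31  -0.02   25774   25565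
    1e9  (.5,1.2)   31231598  -1.3e-3   -39848   -41549.4    +1701  +0.30  130094  130243
    4e9  (.5,1.2)  125342363  -8.4e-4  -104949  -107204.6    +2256  +0.20  345130  344653
    1e9  (.5,1.3)   63410050  -8.9e-4   -56378   -65151.0    +8773  +1.10  170186  170093
    1e9 (.52,1.15)   9755627  -1.4e-3   -13417    -5890.8    -7526  -2.41   56912   56874
    4e9 (.505,1.2) 112473704  -8.3e-4   -93702   -95719.3    +2017  +0.19  309263  308769
    4e9 (.55,1.2)   29329761  -4.2e-4   -12187   -11658.6     -528  -0.10   88028   87974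
  ```
  Over ALL cells `θ ∈ {.5,.505,.51,.52,.55,.6} × λ ∈ {1.05,…,1.3}` and five scales 10⁶…4·10⁹ (260 cell-scale
  pairs, evidence/corner_decomposition.md on the item): `|D|/√N ≤ 2.41`, mean ≈ 0, no trend in x.  `N` matches `M` to 10⁻⁴; `NSQ` matches `Esq` to < 1 %.
  ALL the visible structure of `J^c` sits in the PROVED part `E` — a Chebyshev-type negative bias of `(Q|Q')` over
  prime pairs (`J/N = E/M ≈ −3·10⁻³` at 10⁷–10⁸, `−1.3·10⁻³` at 10⁹, `−8·10⁻⁴` at 4·10⁹: decaying, roughly like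
  `x^{−1/4}` per the `x^{1−θ/2}` heuristic, after a plateau 10⁷–10⁸) plus the positive `NSQ` family — while the OPEN
  part `D` cancels to square-root level with constant `< 2.5` and no drift, no t-decile structure beyond the E-bias
  (block z-scores), no cofactor-class structure (sister seat), no structured-`h` resonance in `T_h` (ideator 1,
  `h = 2k²`; refuter kit j008654/j008680).  Full-`J_θ` rows reproduce the sister kill table at 10⁸ (`θ = .6: +7265`,
  `θ = .7: +4720`, kit j014067).  KILL-SCALE VERDICT: `|J^c|/N ≤ 9·10⁻⁴` at 4·10⁹ in every cell with `λ ≥ 1.1`,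
  decreasing in `x`; the crux survives.
* §D LINE `Sketch` (lead prover-line-stmt-Parity-15002-0; stubs `stub_cornerPairForm`, `stub_cornerExpectedPart`,
  `stub_gaussCoordinateSplit`, `stub_typeI2_typeII_inputs` = K1 ∧ K2, `stub_mbb_of_typeI2_typeII`):
  - T0 `stub_gaussCoordinateSplit` is CORRECTLY TYPED: exact rational check of the three-phase identity with the
    Lean conventions (`ZMod.val` of inverses, `a : ℤ` of either sign, `b = 1`, `n = 1`, `Q = 1`, `h ≤ 0` included):
    12848 admissible cases, 0 failures (`exp/gauss_split_test.py`).
  - K1 `SmoothTwistedTypeI2` cheapest falsifier extended (exp/smooth.c; ordered pairs, non-squarefree moduli included,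
    `L = 1`, `N₁ = N₂ = N`): `|T(k)|/L2 ≤ 3.65` for `k ∈ {1,2,3,4,8,9,18}` (the theta-resonant `2k²` included) and
    `N = 4000 … 64000` (3.3·10⁷ pairs), and `k ∈ {2, 9}` at `N = 128000` (1.24·10⁸ pairs: `T/L2 = +1.85, −1.35`);
    `T(2)/pairs = .0095, .0079, .0069, .0014, .0016, .0005` — decreasing, no plateau, no `N^{3/4}` law (`T/(N₁N₂)^{3/4}`
    fluctuates in sign and size).  K1 survives its falsifier to `N = 1.28·10⁵`.
  - JOINT SUFFICIENCY GAP (for the lead; not refutable, since `MBB` true would make the implication true):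
    `stub_mbb_of_typeI2_typeII` cannot come out of Heath-Brown/Vaughan identities with K1 ∧ K2 AS TYPED.  Opening
    BOTH prime indicators of `twistedSum` multiplies pieces: with `Q = m₁⋯m_j·n₁⋯n_j`, `Q' = m'₁⋯n'_j'` the symbol
    splits as `Π (a_i | b_j)` over all factor pairs.  (i) K1 (`smoothTwistedSum`) has ONE smooth variable per side
    and coefficient `1`: pieces with two large smooth factors on a side (`n₁ ~ n₂ ~ P^{1/2} = N^{1/4}`, beyond K2's
    `M ≤ N^{13/100}`) are neither K1 (divisor-type coefficient `1∗1`, not `1`) nor K2; (ii) the cross symbols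
    `(L₁-part | q)`, `(n | L₂-part)` are quadratic characters of conductor `≤ 4N^η` on the smooth variables — K1 has
    no character slot and is stated for the full progression `n ≡ 1 (4)`, not for classes mod `4L₁L₂`; (iii) K2's
    co-factor `f` is SMOOTH (no coefficient), so it is a Type-I/II hybrid, not Type II: pieces `Q = m·(n₁n₂)` with
    `m ~ N^{0.1}` are not instances.  Minimal repair the lead should consider: K1 for coefficient families
    `{1, log, 1∗1, χ·}` with characters of conductor `≤ N^η` on each smooth variable (or class-restricted versions),
    and K2 with an arbitrary bounded coefficient on `f` (true Type II) — at which point K2's range question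
    (`M` up to where?) is Merikoski's open balanced case again (B7 of Ideator2BarrierNotes).  Posted to the item as
    `stub-misstated: stub_mbb_of_typeI2_typeII`.
* §E NEAR-MISSES (`sorry` only here): `not_SplitBlockJacobiCornerWithoutThetaLower` (data above).

WHY IT RESISTS (one paragraph for provers).  `J^c = E^c + D^c`; `E^c = o(x)` is a theorem (reciprocity + large
sieve, rescaled), and carries every secular feature seen in the data; `D^c` is a bilinear form in two balanced primes
with kernel `(Q|Q') × (small-root discrepancy of −1 mod QQ')`, numerically at noise level `|D^c| < 2.5√N` up to 4·10⁹ with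
no drift, no t-decile structure (block z-scores of variance ≈ 1), no cofactor-class structure (sister seat), no
structured-`h` resonance in `T_h` (ideator 1, h = 2k²; refuter kit j008654/j008680).  A refutation needs a bias of
order `x` in `D^c`, i.e. a correlation between `(Q|Q')` and the position of the roots of −1 mod QQ' at relative scale
`x/QQ' = x^{−(λ−1)}`; the Gaussian/SL₂(ℤ) bookkeeping makes `(Q|Q')` a free spin symbol with no quadratic-level
constraint tied to root size (negative Pell is automatic along t²+1; Scholz-type constraints are quartic).  I found no
mechanism and no numerical trace of one.  The statement is as hard as a power saving for the mixed
Kloosterman-fraction × real-character kernel (MBB), and exactly as plausible.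
-/

namespace Summit.Parity.BatemanHorn.Cruxes.SplitBlockJacobiCorner.Disproof

open Finset Filter Asymptotics
open Summit.Parity.BatemanHorn.Theses.IsogenyRedei (SplitBlockJacobiCorner)

noncomputable section

/-! ## §0 The crux's function -/

/-- The CORNER pair set at parameters `θ, μ, x, t`: ordered pairs `(Q, Q')` of prime factors of `t² + 1` with
`x^θ < Q < Q'` and `QQ' ≤ x^{2−μ}` (verbatim the crux's filter). -/
def cpairs (θ μ : ℝ) (x t : ℕ) : Finset (ℕ × ℕ) :=
  ((t ^ 2 + 1).primeFactors ×ˢ (t ^ 2 + 1).primeFactors).filter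
    (fun q : ℕ × ℕ => (x : ℝ) ^ θ < (q.1 : ℝ) ∧ q.1 < q.2 ∧ ((q.1 * q.2 : ℕ) : ℝ) ≤ (x : ℝ) ^ (2 - μ))

/-- `Jc θ μ x = J^c_{θ,μ}(x)`, the corner sum of the crux. -/
def Jc (θ μ : ℝ) (x : ℕ) : ℝ :=
  ∑ t ∈ Icc 1 x, ∑ q ∈ cpairs θ μ x t, (jacobiSym (q.1 : ℤ) q.2 : ℝ)

/-- The crux, restated through `Jc` (definitionally). -/
theorem splitBlockJacobiCorner_iff :
    SplitBlockJacobiCorner ↔ ∃ δ : ℝ, 0 < δ ∧ ∀ θ μ : ℝ, 1 / 2 < θ → 1 - δ ≤ μ → μ < 2 - 2 * θ →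
      (fun x : ℕ => Jc θ μ x) =o[atTop] fun x : ℕ => (x : ℝ) :=
  Iff.rfl

theorem mem_cpairs {θ μ : ℝ} {x t : ℕ} {q : ℕ × ℕ} :
    q ∈ cpairs θ μ x t ↔ q ∈ (t ^ 2 + 1).primeFactors ×ˢ (t ^ 2 + 1).primeFactors ∧
      ((x : ℝ) ^ θ < (q.1 : ℝ) ∧ q.1 < q.2 ∧ ((q.1 * q.2 : ℕ) : ℝ) ≤ (x : ℝ) ^ (2 - μ)) :=
  Finset.mem_filter

/-! ## §A Load-bearing analysis -/

/-- The size bookkeeping behind every range statement of the corner: `x^θ < Q < Q'` with `0 < θ` gives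
`x^{2θ} < QQ'`. [folklore] -/
theorem rpow_two_mul_lt {θ : ℝ} (hθ : 0 < θ) {x Q Q' : ℕ} (h1 : (x : ℝ) ^ θ < Q) (h2 : Q < Q') :
    (x : ℝ) ^ (2 * θ) < ((Q * Q' : ℕ) : ℝ) := by
  have hx0 : (0 : ℝ) ≤ x := Nat.cast_nonneg x
  have hpow0 : (0 : ℝ) ≤ (x : ℝ) ^ θ := Real.rpow_nonneg hx0 θ
  have hQpos : (0 : ℝ) < Q := hpow0.trans_lt h1
  have hQQ' : (Q : ℝ) < Q' := by exact_mod_cast h2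
  have hsq : (x : ℝ) ^ (2 * θ) = (x : ℝ) ^ θ * (x : ℝ) ^ θ := by
    rw [two_mul, Real.rpow_add' hx0 (by linarith)]
  rw [hsq]
  push_cast
  calc (x : ℝ) ^ θ * (x : ℝ) ^ θ ≤ (Q : ℝ) * (x : ℝ) ^ θ := by gcongr
    _ < Q * Q' := by gcongr; exact h1.trans hQQ'

/-- **`μ < 2 − 2θ` is not load-bearing, I.** For `μ ≥ 2 − 2θ` (and `θ > 0`) the corner pair set is EMPTY for every
`x, t`: `QQ' > x^{2θ} ≥ x^{2−μ}` contradicts the product cut (for `x = 0` the cut reads `QQ' ≤ 0^{2−μ} ≤ 1`). -/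
theorem cpairs_eq_empty_of_le {θ μ : ℝ} (hθ : 0 < θ) (hμ : 2 - 2 * θ ≤ μ) (x t : ℕ) :
    cpairs θ μ x t = ∅ := by
  refine Finset.eq_empty_of_forall_notMem ?_
  intro q hq
  rw [mem_cpairs] at hq
  obtain ⟨-, h1, h2, h3⟩ := hq
  have hlt := rpow_two_mul_lt hθ h1 h2
  rcases Nat.eq_zero_or_pos x with rfl | hx
  · have h0 : ((0 : ℕ) : ℝ) = 0 := Nat.cast_zero
    rw [h0] at h1 h3
    have hQ1 : 0 < q.1 := by
      have : (0 : ℝ) < q.1 := (Real.rpow_nonneg le_rfl θ).trans_lt h1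
      exact_mod_cast this
    have hprod : 2 ≤ q.1 * q.2 := by nlinarith [h2, hQ1]
    have hprodR : (2 : ℝ) ≤ ((q.1 * q.2 : ℕ) : ℝ) := by exact_mod_cast hprod
    have h01 : (0 : ℝ) ^ (2 - μ) ≤ 1 := Real.zero_rpow_le_one _
    linarith
  · have hx1 : (1 : ℝ) ≤ x := by exact_mod_cast hx
    have hle : (x : ℝ) ^ (2 - μ) ≤ (x : ℝ) ^ (2 * θ) :=
      Real.rpow_le_rpow_of_exponent_le hx1 (by linarith)
    linarith

/-- **`μ < 2 − 2θ` is not load-bearing, II.** Hence the corner sum VANISHES identically for `μ ≥ 2 − 2θ`. -/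
theorem Jc_eq_zero_of_le {θ μ : ℝ} (hθ : 0 < θ) (hμ : 2 - 2 * θ ≤ μ) (x : ℕ) : Jc θ μ x = 0 := by
  unfold Jc
  refine Finset.sum_eq_zero fun t _ => ?_
  rw [cpairs_eq_empty_of_le hθ hμ, Finset.sum_empty]

/-- The crux with the hypothesis `μ < 2 − 2θ` DROPPED. -/
def SplitBlockJacobiCornerWithoutMuUpper : Prop :=
  ∃ δ : ℝ, 0 < δ ∧ ∀ θ μ : ℝ, 1 / 2 < θ → 1 - δ ≤ μ →
    (fun x : ℕ => Jc θ μ x) =o[atTop] fun x : ℕ => (x : ℝ)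

/-- **`μ < 2 − 2θ` is not load-bearing, III** (the equivalence): dropping the upper cut on `μ` does not change the
statement, because the added cases are empty sums.  Information for the planner/prover: the hypothesis only records
where the corner is non-empty; no proof needs it. -/
theorem splitBlockJacobiCorner_iff_withoutMuUpper :
    SplitBlockJacobiCorner ↔ SplitBlockJacobiCornerWithoutMuUpper := by
  rw [splitBlockJacobiCorner_iff]
  constructor
  · rintro ⟨δ, hδ, h⟩
    refine ⟨δ, hδ, fun θ μ hθ hμ => ?_⟩
    by_cases hup : μ < 2 - 2 * θ
    · exact h θ μ hθ hμ hup
    · have hz : (fun x : ℕ => Jc θ μ x) = fun _ => (0 : ℝ) :=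
        funext fun x => Jc_eq_zero_of_le (by linarith) (by linarith) x
      rw [hz]
      exact Asymptotics.isLittleO_zero _ _
  · rintro ⟨δ, hδ, h⟩
    exact ⟨δ, hδ, fun θ μ hθ hμ _ => h θ μ hθ hμ⟩

/-- The crux with the hypothesis `1/2 < θ` DROPPED (all real `θ`; at `θ ≤ 0` every prime factor counts, `Q = 2`
included). Numerically FALSE — see `not_SplitBlockJacobiCornerWithoutThetaLower`. -/
def SplitBlockJacobiCornerWithoutThetaLower : Prop :=
  ∃ δ : ℝ, 0 < δ ∧ ∀ θ μ : ℝ, 1 - δ ≤ μ → μ < 2 - 2 * θ →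
    (fun x : ℕ => Jc θ μ x) =o[atTop] fun x : ℕ => (x : ℝ)

/-! ## §B The sign-coherent family inside the corner -/

/-- **Forced squares.** If `Q ≡ 1 (mod 4)` and `Q' = Q + 4s²` with `gcd(2s, Q) = 1`, then `(Q | Q') = +1`:
by reciprocity `(Q|Q') = (Q'|Q) = (4s²|Q) = 1`.  Every corner pair with `Q' − Q = 4□` therefore contributes `+1`
(both primes are `≡ 1 (mod 4)` as odd prime factors of `t²+1`, and `Q ∤ s` since `s < Q'` and `Q' ≠ Q` is prime);
this is the measured positive secular term of the corner (`NSQ ≍ x^{1−θ/2}/log`, docblock §B), which refutes the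
natural strengthening "`J^c_{θ,μ}(x) = O(√x)`" but is `o(x)`. [folklore] -/
theorem jacobiSym_eq_one_of_eq_add_four_mul_sq {Q Q' s : ℕ} (hQ : Q % 4 = 1) (hQ' : Q' = Q + 4 * s ^ 2)
    (hs : Nat.Coprime (2 * s) Q) : jacobiSym (Q : ℤ) Q' = 1 := by
  subst hQ'
  have hodd : Odd (Q + 4 * s ^ 2) := by
    have hQodd : Odd Q := Nat.odd_iff.mpr (by omega)
    rcases hQodd with ⟨k, hk⟩
    exact ⟨k + 2 * s ^ 2, by omega⟩
  rw [jacobiSym.quadratic_reciprocity_one_mod_four hQ hodd, jacobiSym.mod_left]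
  have hmod : ((Q + 4 * s ^ 2 : ℕ) : ℤ) % (Q : ℤ) = (((2 * s : ℕ) : ℤ) ^ 2) % (Q : ℤ) := by
    push_cast
    have : (Q : ℤ) + 4 * (s : ℤ) ^ 2 = (2 * (s : ℤ)) ^ 2 + (Q : ℤ) * 1 := by ring
    rw [this, Int.add_mul_emod_self_left]
  rw [hmod, ← jacobiSym.mod_left]
  apply jacobiSym.sq_one'
  rw [Int.gcd_natCast_natCast]
  exact hs

/-- Both signs occur among corner-shaped configurations `t² + 1 = m·Q·Q'` (small witnesses, `decide`):
`18² + 1 = 325 = 5²·13` is excluded (prime powers), but `57² + 1 = 3250 = 2·5³·13`, … — the clean semiprime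
witnesses: `8² + 1 = 65 = 5·13` with `(5|13) = −1`, and `12² + 1 = 145 = 5·29` with `(5|29) = +1`.
Divisibility alone imposes no sign. -/
theorem sign_both_examples :
    jacobiSym 5 13 = -1 ∧ jacobiSym 5 29 = 1 ∧ (8 ^ 2 + 1 = 5 * 13 ∧ 12 ^ 2 + 1 = 5 * 29) := by
  refine ⟨by norm_num, by norm_num, by norm_num⟩

/-! ## §E Near-misses and refuted strengthenings (work items; `sorry` allowed ONLY here) -/

/-- NEAR-MISS (numerically certain, not cheaply formalisable): the crux with `1/2 < θ` dropped is FALSE.  At `θ = 0`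
(so `x^θ = 1 < Q` for every prime, `Q = 2` included) and any `μ < 2` the corner cut `QQ' ≤ x^{2−μ} → ∞` admits every
fixed small pair eventually, and `Jc 0 μ x = 4x·c(x^{2−μ}) + O(x^{2−μ})` with `c(y) = Σ_{Q<Q', QQ' ≤ y}
(Q|Q')ρ(Q)ρ(Q')/(4QQ') → c₀/4`, `c₀ ≈ −0.43` (sister seat: partial sums −0.369, −0.418, −0.427, −0.4300, −0.4305 at
10², …, 3·10⁵, kit j004900; `J_0(x)/x = −0.429 … −0.431` for `x = 2.5·10⁴ … 10⁷`, kit j004903).  Obstruction to a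
Lean proof: an effective lower bound for the tail of a conditionally convergent double series over primes. -/
theorem not_SplitBlockJacobiCornerWithoutThetaLower : ¬ SplitBlockJacobiCornerWithoutThetaLower := by
  sorry

end

end Summit.Parity.BatemanHorn.Cruxes.SplitBlockJacobiCorner.Disproof
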